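import Summits.Ventures.CertifiedManyBodySolver.Observables.ClusterCapTPrimeTransport
import Summits.Ventures.CertifiedManyBodySolver.Observables.ClusterCapCouplingTransport
import HarnessLib

/-!
# The combined TWO-FIELD DOCC DIAG-HOP cluster node («x2dk», eleven conjuncts) and its projections onto the
# node shapes the three transports consume (field: obsth-2; coupling `U`: pin-1 p489860; diagonal hopping `t′`: pin-1 p488589)

Cell hubbard-obs (nodes lane; seat hubbard-obs-pin-1 g4). A producer that prints, for ONE certified integer vector `ψ` of the open `a × b` `t–t′`
sourced box, the exact rows E_{t′}(h), E_{t′}(0), N, D = Σ_x n_{x↑}n_{x↓} and T₂ = `hamiltonian (rectBoxDiagGraph a b) 1 0` (hubbard-pc-lens-anomaly-1's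
`CAPTP-K2-RATIONALS.json`, 2026-08-27T02:55Z; pilot-1's capU2/capU3 vectors carry D and await T₂) gives the ELEVEN-conjunct node
`∃ ψ, parity ∧ unit ∧ E_{t′}(h) ≤ u·(ab) ∧ nlo·(ab) ≤ N ∧ N ≤ nhi·(ab) ∧ e0lo·(ab) ≤ E_{t′}(0) ∧ E_{t′}(0) ≤ e0hi·(ab) ∧ dlo·(ab) ≤ D ∧ D ≤ dhi·(ab)
 ∧ k2lo·(ab) ≤ T₂ ∧ T₂ ≤ k2hi·(ab)` (obsth-2's seven-conjunct two-field `t–t′` node VERBATIM, then the docc rows, then the diag-hop rows). This file only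
PROJECTS it — onto the two-field docc node (`ClusterCapCouplingTransport`: move in `U`), the two-field diag-hop node (`ClusterCapTPrimeTransport`: move in
`t′`), and obsth-2's two-field node (move in `h`) — and composes the two one-step transports (`…_at_tp_{down,up}_…`, `…_at_coupling_{down,up}_…`) so a
consumer reads ONE certified vector at any (t″, U′, h′) of its μ-pencil by chaining: x2dk ⇒ (t′-step keeps the docc rows? no — each step returns obsth-2's
seven-conjunct node; to move along TWO axes use `twoFieldDoccNodeTT'_at_tp_{down,up}_of_twoFieldDoccDiagHopNodeTT'` below, which keeps the docc rows through the
t′-step, then `twoFieldNodeTT'_at_coupling_{down,up}_of_twoFieldDoccNodeTT'`). HONEST FRAMING: exact bookkeeping on ONE trial state (a variational CEILING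
moved along its own affine lines); leaves fed by it are CONDITIONAL cap rows / large-field finite-h RESPONSE floors (CANDIDATE until readers + referee), never
order parameters, no phase word, not a superconductivity verdict. Zero compute; no definition; no named fact; no `sorry`.
References: D. Ruelle, *Statistical Mechanics: Rigorous Results* (1969) §3.3; Xu et al., Science 384 (2024) eadh7691 eq. (1); Koma–Tasaki, J. Stat. Phys. 76 (1994) 745 §1.
-/

noncomputable section

namespace Summit.Ventures.CertifiedManyBodySolver.Observables

open Matrix Literature.Probability.LatticeModels
open Literature.MathematicalPhysics.QuantumLattice Literature.MathematicalPhysics.QuantumLattice.ThermodynamicLimit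
open Literature.MathematicalPhysics.QuantumLattice.TwoCluster
open scoped ComplexOrder

section Projections

variable {a b : ℕ} (tp U μ : ℝ) {tp' U' h u nlo nhi e0lo e0hi dlo dhi k2lo k2hi : ℝ}

/-- **x2dk ⇒ two-field DOCC node** (drop the diag-hop rows): the nine-conjunct shape `ClusterCapCouplingTransport` moves along `U`
(`twoFieldNodeTT'_at_coupling_{down,up}_of_twoFieldDoccNodeTT'`). [cite: Ruelle1969, §3.3] -/
theorem twoFieldDoccNodeTT'_of_twoFieldDoccDiagHopNodeTT'
    (hC : ∃ ψ : Fock (Orb (Fin a ×ₗ Fin b)), HasParity 0 ψ ∧ star ψ ⬝ᵥ ψ = 1 ∧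
      (star ψ ⬝ᵥ (dWaveSourceOpenBoxTT' a b tp U μ h *ᵥ ψ)).re ≤ u * ((a : ℝ) * b) ∧
      nlo * ((a : ℝ) * b) ≤ (star ψ ⬝ᵥ (totalNumber *ᵥ ψ)).re ∧
      (star ψ ⬝ᵥ (totalNumber *ᵥ ψ)).re ≤ nhi * ((a : ℝ) * b) ∧
      e0lo * ((a : ℝ) * b) ≤ (star ψ ⬝ᵥ (dWaveSourceOpenBoxTT' a b tp U μ 0 *ᵥ ψ)).re ∧
      (star ψ ⬝ᵥ (dWaveSourceOpenBoxTT' a b tp U μ 0 *ᵥ ψ)).re ≤ e0hi * ((a : ℝ) * b) ∧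
      dlo * ((a : ℝ) * b) ≤ (star ψ ⬝ᵥ ((∑ x : Fin a ×ₗ Fin b, numberOp x 0 * numberOp x 1) *ᵥ ψ)).re ∧
      (star ψ ⬝ᵥ ((∑ x : Fin a ×ₗ Fin b, numberOp x 0 * numberOp x 1) *ᵥ ψ)).re ≤ dhi * ((a : ℝ) * b) ∧
      k2lo * ((a : ℝ) * b) ≤ (star ψ ⬝ᵥ (hamiltonian (rectBoxDiagGraph a b) 1 0 *ᵥ ψ)).re ∧
      (star ψ ⬝ᵥ (hamiltonian (rectBoxDiagGraph a b) 1 0 *ᵥ ψ)).re ≤ k2hi * ((a : ℝ) * b)) :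
    ∃ ψ : Fock (Orb (Fin a ×ₗ Fin b)), HasParity 0 ψ ∧ star ψ ⬝ᵥ ψ = 1 ∧
      (star ψ ⬝ᵥ (dWaveSourceOpenBoxTT' a b tp U μ h *ᵥ ψ)).re ≤ u * ((a : ℝ) * b) ∧
      nlo * ((a : ℝ) * b) ≤ (star ψ ⬝ᵥ (totalNumber *ᵥ ψ)).re ∧
      (star ψ ⬝ᵥ (totalNumber *ᵥ ψ)).re ≤ nhi * ((a : ℝ) * b) ∧
      e0lo * ((a : ℝ) * b) ≤ (star ψ ⬝ᵥ (dWaveSourceOpenBoxTT' a b tp U μ 0 *ᵥ ψ)).re ∧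
      (star ψ ⬝ᵥ (dWaveSourceOpenBoxTT' a b tp U μ 0 *ᵥ ψ)).re ≤ e0hi * ((a : ℝ) * b) ∧
      dlo * ((a : ℝ) * b) ≤ (star ψ ⬝ᵥ ((∑ x : Fin a ×ₗ Fin b, numberOp x 0 * numberOp x 1) *ᵥ ψ)).re ∧
      (star ψ ⬝ᵥ ((∑ x : Fin a ×ₗ Fin b, numberOp x 0 * numberOp x 1) *ᵥ ψ)).re ≤ dhi * ((a : ℝ) * b) := by
  obtain ⟨ψ, hp, h1, hE, hNlo, hNhi, hE0lo, hE0hi, hDlo, hDhi, -, -⟩ := hC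
  exact ⟨ψ, hp, h1, hE, hNlo, hNhi, hE0lo, hE0hi, hDlo, hDhi⟩

/-- **x2dk ⇒ two-field DIAG-HOP node** (drop the docc rows): the nine-conjunct shape `ClusterCapTPrimeTransport` moves along `t′`
(`twoFieldNodeTT'_at_tp_{down,up}_of_twoFieldDiagHopNode`). [cite: Ruelle1969, §3.3] -/
theorem twoFieldDiagHopNodeTT'_of_twoFieldDoccDiagHopNodeTT'
    (hC : ∃ ψ : Fock (Orb (Fin a ×ₗ Fin b)), HasParity 0 ψ ∧ star ψ ⬝ᵥ ψ = 1 ∧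
      (star ψ ⬝ᵥ (dWaveSourceOpenBoxTT' a b tp U μ h *ᵥ ψ)).re ≤ u * ((a : ℝ) * b) ∧
      nlo * ((a : ℝ) * b) ≤ (star ψ ⬝ᵥ (totalNumber *ᵥ ψ)).re ∧
      (star ψ ⬝ᵥ (totalNumber *ᵥ ψ)).re ≤ nhi * ((a : ℝ) * b) ∧
      e0lo * ((a : ℝ) * b) ≤ (star ψ ⬝ᵥ (dWaveSourceOpenBoxTT' a b tp U μ 0 *ᵥ ψ)).re ∧
      (star ψ ⬝ᵥ (dWaveSourceOpenBoxTT' a b tp U μ 0 *ᵥ ψ)).re ≤ e0hi * ((a : ℝ) * b) ∧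
      dlo * ((a : ℝ) * b) ≤ (star ψ ⬝ᵥ ((∑ x : Fin a ×ₗ Fin b, numberOp x 0 * numberOp x 1) *ᵥ ψ)).re ∧
      (star ψ ⬝ᵥ ((∑ x : Fin a ×ₗ Fin b, numberOp x 0 * numberOp x 1) *ᵥ ψ)).re ≤ dhi * ((a : ℝ) * b) ∧
      k2lo * ((a : ℝ) * b) ≤ (star ψ ⬝ᵥ (hamiltonian (rectBoxDiagGraph a b) 1 0 *ᵥ ψ)).re ∧
      (star ψ ⬝ᵥ (hamiltonian (rectBoxDiagGraph a b) 1 0 *ᵥ ψ)).re ≤ k2hi * ((a : ℝ) * b)) :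
    ∃ ψ : Fock (Orb (Fin a ×ₗ Fin b)), HasParity 0 ψ ∧ star ψ ⬝ᵥ ψ = 1 ∧
      (star ψ ⬝ᵥ (dWaveSourceOpenBoxTT' a b tp U μ h *ᵥ ψ)).re ≤ u * ((a : ℝ) * b) ∧
      nlo * ((a : ℝ) * b) ≤ (star ψ ⬝ᵥ (totalNumber *ᵥ ψ)).re ∧
      (star ψ ⬝ᵥ (totalNumber *ᵥ ψ)).re ≤ nhi * ((a : ℝ) * b) ∧
      e0lo * ((a : ℝ) * b) ≤ (star ψ ⬝ᵥ (dWaveSourceOpenBoxTT' a b tp U μ 0 *ᵥ ψ)).re ∧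
      (star ψ ⬝ᵥ (dWaveSourceOpenBoxTT' a b tp U μ 0 *ᵥ ψ)).re ≤ e0hi * ((a : ℝ) * b) ∧
      k2lo * ((a : ℝ) * b) ≤ (star ψ ⬝ᵥ (hamiltonian (rectBoxDiagGraph a b) 1 0 *ᵥ ψ)).re ∧
      (star ψ ⬝ᵥ (hamiltonian (rectBoxDiagGraph a b) 1 0 *ᵥ ψ)).re ≤ k2hi * ((a : ℝ) * b) := by
  obtain ⟨ψ, hp, h1, hE, hNlo, hNhi, hE0lo, hE0hi, -, -, hKlo, hKhi⟩ := hC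
  exact ⟨ψ, hp, h1, hE, hNlo, hNhi, hE0lo, hE0hi, hKlo, hKhi⟩

/-- **x2dk ⇒ obsth-2's two-field `t–t′` node** (drop both docc and diag-hop rows): `ClusterCapFieldTransport` §5 moves along `h`.
[cite: Ruelle1969, §3.3] -/
theorem twoFieldNodeTT'_of_twoFieldDoccDiagHopNodeTT'
    (hC : ∃ ψ : Fock (Orb (Fin a ×ₗ Fin b)), HasParity 0 ψ ∧ star ψ ⬝ᵥ ψ = 1 ∧
      (star ψ ⬝ᵥ (dWaveSourceOpenBoxTT' a b tp U μ h *ᵥ ψ)).re ≤ u * ((a : ℝ) * b) ∧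
      nlo * ((a : ℝ) * b) ≤ (star ψ ⬝ᵥ (totalNumber *ᵥ ψ)).re ∧
      (star ψ ⬝ᵥ (totalNumber *ᵥ ψ)).re ≤ nhi * ((a : ℝ) * b) ∧
      e0lo * ((a : ℝ) * b) ≤ (star ψ ⬝ᵥ (dWaveSourceOpenBoxTT' a b tp U μ 0 *ᵥ ψ)).re ∧
      (star ψ ⬝ᵥ (dWaveSourceOpenBoxTT' a b tp U μ 0 *ᵥ ψ)).re ≤ e0hi * ((a : ℝ) * b) ∧
      dlo * ((a : ℝ) * b) ≤ (star ψ ⬝ᵥ ((∑ x : Fin a ×ₗ Fin b, numberOp x 0 * numberOp x 1) *ᵥ ψ)).re ∧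
      (star ψ ⬝ᵥ ((∑ x : Fin a ×ₗ Fin b, numberOp x 0 * numberOp x 1) *ᵥ ψ)).re ≤ dhi * ((a : ℝ) * b) ∧
      k2lo * ((a : ℝ) * b) ≤ (star ψ ⬝ᵥ (hamiltonian (rectBoxDiagGraph a b) 1 0 *ᵥ ψ)).re ∧
      (star ψ ⬝ᵥ (hamiltonian (rectBoxDiagGraph a b) 1 0 *ᵥ ψ)).re ≤ k2hi * ((a : ℝ) * b)) :
    ∃ ψ : Fock (Orb (Fin a ×ₗ Fin b)), HasParity 0 ψ ∧ star ψ ⬝ᵥ ψ = 1 ∧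
      (star ψ ⬝ᵥ (dWaveSourceOpenBoxTT' a b tp U μ h *ᵥ ψ)).re ≤ u * ((a : ℝ) * b) ∧
      nlo * ((a : ℝ) * b) ≤ (star ψ ⬝ᵥ (totalNumber *ᵥ ψ)).re ∧
      (star ψ ⬝ᵥ (totalNumber *ᵥ ψ)).re ≤ nhi * ((a : ℝ) * b) ∧
      e0lo * ((a : ℝ) * b) ≤ (star ψ ⬝ᵥ (dWaveSourceOpenBoxTT' a b tp U μ 0 *ᵥ ψ)).re ∧
      (star ψ ⬝ᵥ (dWaveSourceOpenBoxTT' a b tp U μ 0 *ᵥ ψ)).re ≤ e0hi * ((a : ℝ) * b) := by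
  obtain ⟨ψ, hp, h1, hE, hNlo, hNhi, hE0lo, hE0hi, -, -, -, -⟩ := hC
  exact ⟨ψ, hp, h1, hE, hNlo, hNhi, hE0lo, hE0hi⟩

end Projections

/-! ### Two-axis moves: keep the docc rows through the `t′`-step -/

section TwoAxis

variable {a b : ℕ} (U μ : ℝ) {tp tp' h u nlo nhi e0lo e0hi dlo dhi k2lo k2hi : ℝ}

/-- **x2dk ⇒ two-field DOCC node at a SMALLER `t′`** (`t″ ≤ t′`): the `t′`-step of `ClusterCapTPrimeTransport` with the docc rows carried along
(they do not involve `t′`), so `ClusterCapCouplingTransport` can then move the result along `U`. Cap `u + Δ·k2lo`, zero-field rows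
`[e0lo + Δ·k2hi, e0hi + Δ·k2lo]`, `Δ = t″ − t′`. [cite: Ruelle1969, §3.3] -/
theorem twoFieldDoccNodeTT'_at_tp_down_of_twoFieldDoccDiagHopNodeTT' (htp : tp' ≤ tp)
    (hC : ∃ ψ : Fock (Orb (Fin a ×ₗ Fin b)), HasParity 0 ψ ∧ star ψ ⬝ᵥ ψ = 1 ∧
      (star ψ ⬝ᵥ (dWaveSourceOpenBoxTT' a b tp U μ h *ᵥ ψ)).re ≤ u * ((a : ℝ) * b) ∧
      nlo * ((a : ℝ) * b) ≤ (star ψ ⬝ᵥ (totalNumber *ᵥ ψ)).re ∧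
      (star ψ ⬝ᵥ (totalNumber *ᵥ ψ)).re ≤ nhi * ((a : ℝ) * b) ∧
      e0lo * ((a : ℝ) * b) ≤ (star ψ ⬝ᵥ (dWaveSourceOpenBoxTT' a b tp U μ 0 *ᵥ ψ)).re ∧
      (star ψ ⬝ᵥ (dWaveSourceOpenBoxTT' a b tp U μ 0 *ᵥ ψ)).re ≤ e0hi * ((a : ℝ) * b) ∧
      dlo * ((a : ℝ) * b) ≤ (star ψ ⬝ᵥ ((∑ x : Fin a ×ₗ Fin b, numberOp x 0 * numberOp x 1) *ᵥ ψ)).re ∧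
      (star ψ ⬝ᵥ ((∑ x : Fin a ×ₗ Fin b, numberOp x 0 * numberOp x 1) *ᵥ ψ)).re ≤ dhi * ((a : ℝ) * b) ∧
      k2lo * ((a : ℝ) * b) ≤ (star ψ ⬝ᵥ (hamiltonian (rectBoxDiagGraph a b) 1 0 *ᵥ ψ)).re ∧
      (star ψ ⬝ᵥ (hamiltonian (rectBoxDiagGraph a b) 1 0 *ᵥ ψ)).re ≤ k2hi * ((a : ℝ) * b)) :
    ∃ ψ : Fock (Orb (Fin a ×ₗ Fin b)), HasParity 0 ψ ∧ star ψ ⬝ᵥ ψ = 1 ∧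
      (star ψ ⬝ᵥ (dWaveSourceOpenBoxTT' a b tp' U μ h *ᵥ ψ)).re ≤ (u + (tp' - tp) * k2lo) * ((a : ℝ) * b) ∧
      nlo * ((a : ℝ) * b) ≤ (star ψ ⬝ᵥ (totalNumber *ᵥ ψ)).re ∧
      (star ψ ⬝ᵥ (totalNumber *ᵥ ψ)).re ≤ nhi * ((a : ℝ) * b) ∧
      (e0lo + (tp' - tp) * k2hi) * ((a : ℝ) * b) ≤ (star ψ ⬝ᵥ (dWaveSourceOpenBoxTT' a b tp' U μ 0 *ᵥ ψ)).re ∧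
      (star ψ ⬝ᵥ (dWaveSourceOpenBoxTT' a b tp' U μ 0 *ᵥ ψ)).re ≤ (e0hi + (tp' - tp) * k2lo) * ((a : ℝ) * b) ∧
      dlo * ((a : ℝ) * b) ≤ (star ψ ⬝ᵥ ((∑ x : Fin a ×ₗ Fin b, numberOp x 0 * numberOp x 1) *ᵥ ψ)).re ∧
      (star ψ ⬝ᵥ ((∑ x : Fin a ×ₗ Fin b, numberOp x 0 * numberOp x 1) *ᵥ ψ)).re ≤ dhi * ((a : ℝ) * b) := by
  obtain ⟨ψ, hp, h1, hE, hNlo, hNhi, hE0lo, hE0hi, hDlo, hDhi, hKlo, hKhi⟩ := hC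
  exact ⟨ψ, hp, h1, clusterCapTT'_tp_down htp hE hKlo, hNlo, hNhi, clusterFloorTT'_tp_down htp hE0lo hKhi,
    clusterCapTT'_tp_down htp hE0hi hKlo, hDlo, hDhi⟩

/-- **x2dk ⇒ two-field DOCC node at a LARGER `t′`** (`t′ ≤ t″`; cap `u + Δ·k2hi`, zero-field rows `[e0lo + Δ·k2lo, e0hi + Δ·k2hi]`) — e.g. the
A0 capTP vectors (`t′ = −1/4`) read at `t″ = 0` with their docc rows kept. [cite: Ruelle1969, §3.3] -/
theorem twoFieldDoccNodeTT'_at_tp_up_of_twoFieldDoccDiagHopNodeTT' (htp : tp ≤ tp')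
    (hC : ∃ ψ : Fock (Orb (Fin a ×ₗ Fin b)), HasParity 0 ψ ∧ star ψ ⬝ᵥ ψ = 1 ∧
      (star ψ ⬝ᵥ (dWaveSourceOpenBoxTT' a b tp U μ h *ᵥ ψ)).re ≤ u * ((a : ℝ) * b) ∧
      nlo * ((a : ℝ) * b) ≤ (star ψ ⬝ᵥ (totalNumber *ᵥ ψ)).re ∧
      (star ψ ⬝ᵥ (totalNumber *ᵥ ψ)).re ≤ nhi * ((a : ℝ) * b) ∧
      e0lo * ((a : ℝ) * b) ≤ (star ψ ⬝ᵥ (dWaveSourceOpenBoxTT' a b tp U μ 0 *ᵥ ψ)).re ∧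
      (star ψ ⬝ᵥ (dWaveSourceOpenBoxTT' a b tp U μ 0 *ᵥ ψ)).re ≤ e0hi * ((a : ℝ) * b) ∧
      dlo * ((a : ℝ) * b) ≤ (star ψ ⬝ᵥ ((∑ x : Fin a ×ₗ Fin b, numberOp x 0 * numberOp x 1) *ᵥ ψ)).re ∧
      (star ψ ⬝ᵥ ((∑ x : Fin a ×ₗ Fin b, numberOp x 0 * numberOp x 1) *ᵥ ψ)).re ≤ dhi * ((a : ℝ) * b) ∧
      k2lo * ((a : ℝ) * b) ≤ (star ψ ⬝ᵥ (hamiltonian (rectBoxDiagGraph a b) 1 0 *ᵥ ψ)).re ∧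
      (star ψ ⬝ᵥ (hamiltonian (rectBoxDiagGraph a b) 1 0 *ᵥ ψ)).re ≤ k2hi * ((a : ℝ) * b)) :
    ∃ ψ : Fock (Orb (Fin a ×ₗ Fin b)), HasParity 0 ψ ∧ star ψ ⬝ᵥ ψ = 1 ∧
      (star ψ ⬝ᵥ (dWaveSourceOpenBoxTT' a b tp' U μ h *ᵥ ψ)).re ≤ (u + (tp' - tp) * k2hi) * ((a : ℝ) * b) ∧
      nlo * ((a : ℝ) * b) ≤ (star ψ ⬝ᵥ (totalNumber *ᵥ ψ)).re ∧
      (star ψ ⬝ᵥ (totalNumber *ᵥ ψ)).re ≤ nhi * ((a : ℝ) * b) ∧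
      (e0lo + (tp' - tp) * k2lo) * ((a : ℝ) * b) ≤ (star ψ ⬝ᵥ (dWaveSourceOpenBoxTT' a b tp' U μ 0 *ᵥ ψ)).re ∧
      (star ψ ⬝ᵥ (dWaveSourceOpenBoxTT' a b tp' U μ 0 *ᵥ ψ)).re ≤ (e0hi + (tp' - tp) * k2hi) * ((a : ℝ) * b) ∧
      dlo * ((a : ℝ) * b) ≤ (star ψ ⬝ᵥ ((∑ x : Fin a ×ₗ Fin b, numberOp x 0 * numberOp x 1) *ᵥ ψ)).re ∧
      (star ψ ⬝ᵥ ((∑ x : Fin a ×ₗ Fin b, numberOp x 0 * numberOp x 1) *ᵥ ψ)).re ≤ dhi * ((a : ℝ) * b) := by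
  obtain ⟨ψ, hp, h1, hE, hNlo, hNhi, hE0lo, hE0hi, hDlo, hDhi, hKlo, hKhi⟩ := hC
  exact ⟨ψ, hp, h1, clusterCapTT'_tp_up htp hE hKhi, hNlo, hNhi, clusterFloorTT'_tp_up htp hE0lo hKlo,
    clusterCapTT'_tp_up htp hE0hi hKhi, hDlo, hDhi⟩

end TwoAxis

/-! ### `t′ = 0` vectors typed with the plain box `dWaveSourceOpenBox` (pilot-1's capU2/capU3 family): entry and exit at `tp = 0` -/

section ZeroTP

variable {a b : ℕ} (U μ : ℝ) {h u nlo nhi e0lo e0hi dlo dhi k2lo k2hi : ℝ}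

/-- **A plain-box x2dk node is a `t–t′` x2dk node at `t′ = 0`** (`dWaveSourceOpenBox = dWaveSourceOpenBoxTT' … 0 …`): the eleven-conjunct node of a
`t′ = 0` vector written with `dWaveSourceOpenBox a b U μ h` (the shape of pin-1's `cert_capU2x2d_…` editions plus diag-hop rows) enters every transport of
this file and of `ClusterCapTPrimeTransport` / `ClusterCapCouplingTransport` with `tp = 0`. [cite: Ruelle1969, §3.3] -/
theorem twoFieldDoccDiagHopNodeTT'_zero_of_twoFieldDoccDiagHopNode
    (hC : ∃ ψ : Fock (Orb (Fin a ×ₗ Fin b)), HasParity 0 ψ ∧ star ψ ⬝ᵥ ψ = 1 ∧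
      (star ψ ⬝ᵥ (dWaveSourceOpenBox a b U μ h *ᵥ ψ)).re ≤ u * ((a : ℝ) * b) ∧
      nlo * ((a : ℝ) * b) ≤ (star ψ ⬝ᵥ (totalNumber *ᵥ ψ)).re ∧
      (star ψ ⬝ᵥ (totalNumber *ᵥ ψ)).re ≤ nhi * ((a : ℝ) * b) ∧
      e0lo * ((a : ℝ) * b) ≤ (star ψ ⬝ᵥ (dWaveSourceOpenBox a b U μ 0 *ᵥ ψ)).re ∧
      (star ψ ⬝ᵥ (dWaveSourceOpenBox a b U μ 0 *ᵥ ψ)).re ≤ e0hi * ((a : ℝ) * b) ∧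
      dlo * ((a : ℝ) * b) ≤ (star ψ ⬝ᵥ ((∑ x : Fin a ×ₗ Fin b, numberOp x 0 * numberOp x 1) *ᵥ ψ)).re ∧
      (star ψ ⬝ᵥ ((∑ x : Fin a ×ₗ Fin b, numberOp x 0 * numberOp x 1) *ᵥ ψ)).re ≤ dhi * ((a : ℝ) * b) ∧
      k2lo * ((a : ℝ) * b) ≤ (star ψ ⬝ᵥ (hamiltonian (rectBoxDiagGraph a b) 1 0 *ᵥ ψ)).re ∧
      (star ψ ⬝ᵥ (hamiltonian (rectBoxDiagGraph a b) 1 0 *ᵥ ψ)).re ≤ k2hi * ((a : ℝ) * b)) :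
    ∃ ψ : Fock (Orb (Fin a ×ₗ Fin b)), HasParity 0 ψ ∧ star ψ ⬝ᵥ ψ = 1 ∧
      (star ψ ⬝ᵥ (dWaveSourceOpenBoxTT' a b 0 U μ h *ᵥ ψ)).re ≤ u * ((a : ℝ) * b) ∧
      nlo * ((a : ℝ) * b) ≤ (star ψ ⬝ᵥ (totalNumber *ᵥ ψ)).re ∧
      (star ψ ⬝ᵥ (totalNumber *ᵥ ψ)).re ≤ nhi * ((a : ℝ) * b) ∧
      e0lo * ((a : ℝ) * b) ≤ (star ψ ⬝ᵥ (dWaveSourceOpenBoxTT' a b 0 U μ 0 *ᵥ ψ)).re ∧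
      (star ψ ⬝ᵥ (dWaveSourceOpenBoxTT' a b 0 U μ 0 *ᵥ ψ)).re ≤ e0hi * ((a : ℝ) * b) ∧
      dlo * ((a : ℝ) * b) ≤ (star ψ ⬝ᵥ ((∑ x : Fin a ×ₗ Fin b, numberOp x 0 * numberOp x 1) *ᵥ ψ)).re ∧
      (star ψ ⬝ᵥ ((∑ x : Fin a ×ₗ Fin b, numberOp x 0 * numberOp x 1) *ᵥ ψ)).re ≤ dhi * ((a : ℝ) * b) ∧
      k2lo * ((a : ℝ) * b) ≤ (star ψ ⬝ᵥ (hamiltonian (rectBoxDiagGraph a b) 1 0 *ᵥ ψ)).re ∧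
      (star ψ ⬝ᵥ (hamiltonian (rectBoxDiagGraph a b) 1 0 *ᵥ ψ)).re ≤ k2hi * ((a : ℝ) * b) := by
  simpa only [dWaveSourceOpenBoxTT'_zero_tp] using hC

variable (tp : ℝ)

/-- **Exit at `t′ = 0`**: a seven-conjunct two-field `t–t′` node AT `tp = 0` (e.g. an A0 vector moved up to `t″ = 0` by
`twoFieldNodeTT'_at_tp_up_of_twoFieldDiagHopNode`) is obsth-2's plain two-field node, so the `t′ = 0` consumers
(`clusterNode_at_field_{down,up}_of_twoFieldNode`, the canonical continuum leaves) apply verbatim. [cite: Ruelle1969, §3.3] -/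
theorem twoFieldNode_of_twoFieldNodeTT'_zero
    (hC : ∃ ψ : Fock (Orb (Fin a ×ₗ Fin b)), HasParity 0 ψ ∧ star ψ ⬝ᵥ ψ = 1 ∧
      (star ψ ⬝ᵥ (dWaveSourceOpenBoxTT' a b 0 U μ h *ᵥ ψ)).re ≤ u * ((a : ℝ) * b) ∧
      nlo * ((a : ℝ) * b) ≤ (star ψ ⬝ᵥ (totalNumber *ᵥ ψ)).re ∧
      (star ψ ⬝ᵥ (totalNumber *ᵥ ψ)).re ≤ nhi * ((a : ℝ) * b) ∧
      e0lo * ((a : ℝ) * b) ≤ (star ψ ⬝ᵥ (dWaveSourceOpenBoxTT' a b 0 U μ 0 *ᵥ ψ)).re ∧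
      (star ψ ⬝ᵥ (dWaveSourceOpenBoxTT' a b 0 U μ 0 *ᵥ ψ)).re ≤ e0hi * ((a : ℝ) * b)) :
    ∃ ψ : Fock (Orb (Fin a ×ₗ Fin b)), HasParity 0 ψ ∧ star ψ ⬝ᵥ ψ = 1 ∧
      (star ψ ⬝ᵥ (dWaveSourceOpenBox a b U μ h *ᵥ ψ)).re ≤ u * ((a : ℝ) * b) ∧
      nlo * ((a : ℝ) * b) ≤ (star ψ ⬝ᵥ (totalNumber *ᵥ ψ)).re ∧
      (star ψ ⬝ᵥ (totalNumber *ᵥ ψ)).re ≤ nhi * ((a : ℝ) * b) ∧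
      e0lo * ((a : ℝ) * b) ≤ (star ψ ⬝ᵥ (dWaveSourceOpenBox a b U μ 0 *ᵥ ψ)).re ∧
      (star ψ ⬝ᵥ (dWaveSourceOpenBox a b U μ 0 *ᵥ ψ)).re ≤ e0hi * ((a : ℝ) * b) := by
  simpa only [dWaveSourceOpenBoxTT'_zero_tp] using hC

/-- **Entry at `t′ = 0` for the seven-conjunct node**: obsth-2's plain two-field node of a `t′ = 0` vector is a `t–t′` two-field node at `tp = 0`
(so `twoFieldNodeTT'_at_coupling_…` / the TT′ field transport apply to pin-1's `cert_capU2x2_…` nodes too). [cite: Ruelle1969, §3.3] -/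
theorem twoFieldNodeTT'_zero_of_twoFieldNode
    (hC : ∃ ψ : Fock (Orb (Fin a ×ₗ Fin b)), HasParity 0 ψ ∧ star ψ ⬝ᵥ ψ = 1 ∧
      (star ψ ⬝ᵥ (dWaveSourceOpenBox a b U μ h *ᵥ ψ)).re ≤ u * ((a : ℝ) * b) ∧
      nlo * ((a : ℝ) * b) ≤ (star ψ ⬝ᵥ (totalNumber *ᵥ ψ)).re ∧
      (star ψ ⬝ᵥ (totalNumber *ᵥ ψ)).re ≤ nhi * ((a : ℝ) * b) ∧
      e0lo * ((a : ℝ) * b) ≤ (star ψ ⬝ᵥ (dWaveSourceOpenBox a b U μ 0 *ᵥ ψ)).re ∧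
      (star ψ ⬝ᵥ (dWaveSourceOpenBox a b U μ 0 *ᵥ ψ)).re ≤ e0hi * ((a : ℝ) * b)) :
    ∃ ψ : Fock (Orb (Fin a ×ₗ Fin b)), HasParity 0 ψ ∧ star ψ ⬝ᵥ ψ = 1 ∧
      (star ψ ⬝ᵥ (dWaveSourceOpenBoxTT' a b 0 U μ h *ᵥ ψ)).re ≤ u * ((a : ℝ) * b) ∧
      nlo * ((a : ℝ) * b) ≤ (star ψ ⬝ᵥ (totalNumber *ᵥ ψ)).re ∧
      (star ψ ⬝ᵥ (totalNumber *ᵥ ψ)).re ≤ nhi * ((a : ℝ) * b) ∧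
      e0lo * ((a : ℝ) * b) ≤ (star ψ ⬝ᵥ (dWaveSourceOpenBoxTT' a b 0 U μ 0 *ᵥ ψ)).re ∧
      (star ψ ⬝ᵥ (dWaveSourceOpenBoxTT' a b 0 U μ 0 *ᵥ ψ)).re ≤ e0hi * ((a : ℝ) * b) := by
  simpa only [dWaveSourceOpenBoxTT'_zero_tp] using hC

end ZeroTP

end Summit.Ventures.CertifiedManyBodySolver.Observables

end
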